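import Mathlib
import Summits.ValiantsHypothesis.ValiantsHypothesis.Theorems.TriangularDimersDivisionEasy.Negative.LowerBound

/-!
# Crux `DivisionGap.ZeroOneTransfer` (stmt-ValiantsHypothesis-5066), line `charged-uncharged`, Part E
(lead c13): ISOLATING FACES — shared vocabulary

Part E of the line adds necessity rungs for uncharged certificates `X` of the decisive instance
`D_n = triPM n` (Valiant's rhombus dimers, crux 4) obtained from FREE TOP/BOTTOM FORMS that isolate a
single monomial of `X` while `D_n` degenerates to an EDGE-RESTRICTED dimer polynomial which still
contains a full triangular block.  This file only fixes the objects (no statement of the line is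
asserted here):

* `triPMIn E₀` — the dimer polynomial of `R_n` restricted to covers inside an edge predicate `E₀`
  (`Σ_{f ∈ dimers n, ∀ v, E₀ v (f v)} Π_v x_(v, f v)`), the shape of every face of `D_n` used below;
* `SqAdj`, `IsSqDimer`, `sqDimers`, `sqPM n` — the square sub-lattice (edges `(i,j)–(i+1,j)`,
  `(i,j)–(i,j+1)`) and its dimer (domino-tiling) polynomial `Sq_n` in the crux's doubled-variable
  encoding (the bipartite planar partner of `D_n`, item 5072), and `sqPMIn E₀`;
* `InBlock r₀ c₀ m` — the square block `[r₀, r₀+m) × [c₀, c₀+m)` (arbitrary corner) and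
  `blockSubst` — the block substitution (`1` off the block, `0` on pairs leaving it, block-local
  variable inside), generalising stub D1 of Part D from aligned corners;
* `IsHoriz e` — horizontal variables `x_((i,j),(i,j±1))`; `Avoid F` — the edge predicate "neither
  orientation of the pair lies in `F`";
* the BRICK-WALL ZONE of rung E-I (parameters `m` = zone height/width, `b` = left column of the box):
  `wide`, `InZone`, `zoneLeft` (is the cell the left cell of its brick), `brick` (the brick partner),
  `ctr`/`newH`/`u0Nat`/`u0` (the explicit domino tiling of the whole rhombus extending the bricks of the
  two zones — bricks `[j, j+1]` with `j ≡ i (mod 2)` in rows `< m`, `j ≢ i` in rows `[m, 2m)`, the two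
  opposite brick walls whose colour fluxes cancel — by a staircase of horizontal dominoes and a growing
  run of vertical ones on both sides, plain rows below `2m`), `E0sq` (the edge predicate "triangular
  edge inside one zone, or a domino of `u0`"), `G0sq` (its square-lattice part) and the indicator
  weight `wInd`.
[folklore]
-/

namespace Summit.ValiantsHypothesis.ValiantsHypothesis.Theorems.DivisionGapZeroOneTransfer

open MvPolynomial
open Literature.Computability.AlgebraicComplexity
open Summit.ValiantsHypothesis.ValiantsHypothesis.Theorems.TriangularDimersDivisionEasy.Negative
open scoped NNReal BigOperators

set_option linter.dupNamespace false

noncomputable section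

namespace FaceIsolation

variable {n : ℕ}

/-! ### Edge-restricted dimer polynomials -/

/-- The dimer polynomial of `R_n` restricted to the covers lying inside the edge predicate `E₀`:
`Σ_{f ∈ dimers n, ∀ v, E₀ v (f v)} Π_v x_(v, f v)`. [folklore] -/
def triPMIn (E₀ : Vtx n → Vtx n → Prop) [DecidableRel E₀] : MvPolynomial (Var n) ℝ≥0 :=
  ∑ f ∈ (dimers n).filter (fun f => ∀ v, E₀ v (f v)), ∏ v : Vtx n, X (v, f v)

/-! ### The square sub-lattice and its dimer polynomial `Sq_n` -/

/-- Adjacency of the SQUARE sub-lattice of the rhombus: the first four disjuncts of `Adj`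
(edges `(i,j)–(i+1,j)` and `(i,j)–(i,j+1)`, both orientations). [folklore] -/
def SqAdj (v w : Vtx n) : Prop :=
  ((v.1 : ℕ) + 1 = w.1 ∧ (v.2 : ℕ) = w.2) ∨ ((w.1 : ℕ) + 1 = v.1 ∧ (v.2 : ℕ) = w.2) ∨
  ((v.1 : ℕ) = w.1 ∧ (v.2 : ℕ) + 1 = w.2) ∨ ((v.1 : ℕ) = w.1 ∧ (w.2 : ℕ) + 1 = v.2)

/-- Decidability of the square adjacency. [folklore] -/
instance (v w : Vtx n) : Decidable (SqAdj v w) := by unfold SqAdj; infer_instance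

/-- A domino tiling of the rhombus in the crux's encoding: a fixed-point-free involution along
square-lattice edges. [folklore] -/
def IsSqDimer (f : Vtx n → Vtx n) : Prop := ∀ v, f (f v) = v ∧ f v ≠ v ∧ SqAdj v (f v)

/-- Decidability of the domino-tiling predicate. [folklore] -/
instance (f : Vtx n → Vtx n) : Decidable (IsSqDimer f) := by unfold IsSqDimer; infer_instance

/-- The finite set of domino tilings of the `n × n` square. [folklore] -/
def sqDimers (n : ℕ) : Finset (Vtx n → Vtx n) := Finset.univ.filter IsSqDimer

/-- The square-grid dimer polynomial `Sq_n = Σ_f Π_v x_(v, f v)` on the same vertex set and in the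
same doubled-variable encoding as `D_n` (item 5072's polynomial). [folklore] -/
def sqPM (n : ℕ) : MvPolynomial (Var n) ℝ≥0 :=
  ∑ f ∈ sqDimers n, ∏ v : Vtx n, X (v, f v)

/-- `Sq_n` restricted to the tilings inside an edge predicate `E₀`. [folklore] -/
def sqPMIn (E₀ : Vtx n → Vtx n → Prop) [DecidableRel E₀] : MvPolynomial (Var n) ℝ≥0 :=
  ∑ f ∈ (sqDimers n).filter (fun f => ∀ v, E₀ v (f v)), ∏ v : Vtx n, X (v, f v)

/-! ### Blocks with an arbitrary corner and the block substitution -/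

/-- The square block `[r₀, r₀ + m) × [c₀, c₀ + m)` of the rhombus. [folklore] -/
def InBlock (r₀ c₀ m : ℕ) (v : Vtx n) : Prop :=
  r₀ ≤ (v.1 : ℕ) ∧ (v.1 : ℕ) < r₀ + m ∧ c₀ ≤ (v.2 : ℕ) ∧ (v.2 : ℕ) < c₀ + m

/-- Decidability of block membership. [folklore] -/
instance (r₀ c₀ m : ℕ) (v : Vtx n) : Decidable (InBlock r₀ c₀ m v) := by
  unfold InBlock; infer_instance

/-- The chart of the block: subtract the corner (junk off the block). [folklore] -/
def blockChart (r₀ c₀ m : ℕ) (hm : 0 < m) (v : Vtx n) : Vtx m :=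
  (⟨((v.1 : ℕ) - r₀) % m, Nat.mod_lt _ hm⟩, ⟨((v.2 : ℕ) - c₀) % m, Nat.mod_lt _ hm⟩)

/-- The BLOCK SUBSTITUTION: `x_(a,b) ↦ 1` if `a` is off the block, `↦ 0` if `a` is in the block and
`b` is not, `↦` the block-local variable `x_(a - (r₀,c₀), b - (r₀,c₀))` of `D_m` if both are in the
block. [folklore] -/
def blockSubst (r₀ c₀ m : ℕ) (hm : 0 < m) (e : Var n) : MvPolynomial (Var m) ℝ≥0 :=
  if InBlock r₀ c₀ m e.1 then
    (if InBlock r₀ c₀ m e.2 then X (blockChart r₀ c₀ m hm e.1, blockChart r₀ c₀ m hm e.2) else 0)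
  else 1

/-! ### Horizontal variables and avoided pairs (rung E-II) -/

/-- A HORIZONTAL variable `x_((i,j),(i,j±1))`. [folklore] -/
def IsHoriz (e : Var n) : Prop :=
  (e.1.1 : ℕ) = e.2.1 ∧ ((e.1.2 : ℕ) + 1 = e.2.2 ∨ (e.2.2 : ℕ) + 1 = e.1.2)

/-- Decidability of horizontality. [folklore] -/
instance (e : Var n) : Decidable (IsHoriz e) := by unfold IsHoriz; infer_instance

/-- The edge predicate "the pair `{v, w}` is not hit by `F` in either orientation". [folklore] -/
def Avoid (F : Finset (Var n)) (v w : Vtx n) : Prop := (v, w) ∉ F ∧ (w, v) ∉ F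

/-- Decidability of `Avoid`. [folklore] -/
instance (F : Finset (Var n)) (v w : Vtx n) : Decidable (Avoid F v w) := by
  unfold Avoid; infer_instance

/-! ### The brick-wall zone of rung E-I

Parameters: `m` (even; the two zones occupy rows `[0, m)` and `[m, 2m)`), `b` (even, `≥ m + 2`; the
box columns are `[b, b + m)`); the rhombus side `n` is even with `b + 2m + 2 ≤ n`.  A row `i < 2m` is
WIDE if its bricks protrude from the box (`i < m` odd, or `m ≤ i` even: bricks `[b-1,b], …,
[b+m-1, b+m]`) and NARROW otherwise (bricks `[b,b+1], …, [b+m-2, b+m-1]`). -/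

/-- Wide rows of the band `[0, 2m)`. [folklore] -/
def wide (m i : ℕ) : Bool := (decide (i < m) && decide (i % 2 = 1)) || (decide (m ≤ i) && decide (i % 2 = 0))

/-- The zone (union of the bricks of the two brick walls meeting the box), on ℕ-coordinates. [folklore] -/
def inZoneNat (m b : ℕ) (p : ℕ × ℕ) : Prop :=
  p.1 < 2 * m ∧ (if wide m p.1 then b - 1 ≤ p.2 ∧ p.2 ≤ b + m else b ≤ p.2 ∧ p.2 + 1 ≤ b + m)

/-- Decidability of zone membership. [folklore] -/
instance (m b : ℕ) (p : ℕ × ℕ) : Decidable (inZoneNat m b p) := by unfold inZoneNat; infer_instance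

/-- The zone as a predicate on vertices. [folklore] -/
def InZone (m b : ℕ) (v : Vtx n) : Prop := inZoneNat m b ((v.1 : ℕ), (v.2 : ℕ))

/-- Decidability of zone membership of a vertex. [folklore] -/
instance (m b : ℕ) (v : Vtx n) : Decidable (InZone m b v) := by unfold InZone; infer_instance

/-- Is the cell the LEFT cell of its brick?  In wide rows the left cells have odd column, in narrow
rows even column (`b` is even). [folklore] -/
def zoneLeft (m : ℕ) (p : ℕ × ℕ) : Bool := decide (p.2 % 2 = 1) == wide m p.1

/-- The brick partner of a zone cell (right neighbour of a left cell, left neighbour of a right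
cell), on ℕ-coordinates. [folklore] -/
def brick (m : ℕ) (p : ℕ × ℕ) : ℕ × ℕ := if zoneLeft m p then (p.1, p.2 + 1) else (p.1, p.2 - 1)

/-- Distance of a band row from the centre line between rows `m - 1` and `m`. [folklore] -/
def ctr (m i : ℕ) : ℕ := if i < m then m - 1 - i else i - m

/-- The rows that receive a NEW horizontal domino pointing away from the zone at staircase step `t`.
[folklore] -/
def newH (m i t : ℕ) : Bool :=
  (decide (i < m) && decide (i % 2 = t % 2)) || (decide (m ≤ i) && decide (i % 2 ≠ t % 2))

/-- The vertical pairing inside the run `[m - t, m + t) ∩ [0, 2m)` of step `t` (pairs `(m-t+2s, m-t+2s+1)`;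
for `t ≥ m` the run is the whole band and the pairs are `(2s, 2s+1)` — `m` is even). [folklore] -/
def vert (m t : ℕ) (p : ℕ × ℕ) : ℕ × ℕ :=
  if (p.1 + min t m - m) % 2 = 0 then (p.1 + 1, p.2) else (p.1 - 1, p.2)

/-- **The explicit tiling `u₀`** of the `n × n` square extending the bricks of both zones, on
ℕ-coordinates: plain horizontal dominoes in rows `≥ 2m`; bricks in the zone; on the left of the zone,
at column `b - 1 - t`, a vertical run on the rows at centre-distance `< t` and horizontal dominoes
elsewhere (new ones on the rows `newH`, the far ends of the previous step's otherwise); mirror image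
on the right of the zone (columns `b + m + t`). [folklore] -/
def u0Nat (m b : ℕ) (p : ℕ × ℕ) : ℕ × ℕ :=
  if 2 * m ≤ p.1 then (p.1, if p.2 % 2 = 0 then p.2 + 1 else p.2 - 1)
  else if inZoneNat m b p then brick m p
  else if p.2 + 1 ≤ b then
    (if ctr m p.1 < b - 1 - p.2 then vert m (b - 1 - p.2) p
     else if newH m p.1 (b - 1 - p.2) then (p.1, p.2 - 1) else (p.1, p.2 + 1))
  else
    (if ctr m p.1 < p.2 - (b + m) then vert m (p.2 - (b + m)) p
     else if newH m p.1 (p.2 - (b + m)) then (p.1, p.2 + 1) else (p.1, p.2 - 1))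

/-- The explicit tiling `u₀` on vertices (the identity where the ℕ-partner would leave the square —
which does not happen under the hypotheses of rung E-I). [folklore] -/
def u0 (m b : ℕ) (v : Vtx n) : Vtx n :=
  if h : (u0Nat m b ((v.1 : ℕ), (v.2 : ℕ))).1 < n ∧ (u0Nat m b ((v.1 : ℕ), (v.2 : ℕ))).2 < n then
    (⟨_, h.1⟩, ⟨_, h.2⟩)
  else v

/-- The two zones: `zone m k v` for `k = 0` (rows `< m`, brick wall `j ≡ i`) and `k = 1` (rows
`[m, 2m)`, brick wall `j ≢ i`). [folklore] -/
def zone (m b : ℕ) (k : Fin 2) (v : Vtx n) : Prop :=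
  InZone m b v ∧ (if k = 0 then (v.1 : ℕ) < m else m ≤ (v.1 : ℕ))

/-- Decidability of the zones. [folklore] -/
instance (m b : ℕ) (k : Fin 2) (v : Vtx n) : Decidable (zone m b k v) := by unfold zone; infer_instance

/-- The edge predicate of rung E-I: a triangular edge with both ends in the SAME zone, or a domino
of `u₀`. [folklore] -/
def E0sq (m b : ℕ) (v w : Vtx n) : Prop := (∃ k : Fin 2, zone m b k v ∧ zone m b k w ∧ Adj v w) ∨ w = u0 m b v

/-- Decidability of `E0sq`. [folklore] -/
instance (m b : ℕ) (v w : Vtx n) : Decidable (E0sq m b v w) := by unfold E0sq; infer_instance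

/-- Its square-lattice part: a square edge with both ends in the same zone, or a domino of `u₀`.
[folklore] -/
def G0sq (m b : ℕ) (v w : Vtx n) : Prop := (∃ k : Fin 2, zone m b k v ∧ zone m b k w ∧ SqAdj v w) ∨ w = u0 m b v

/-- Decidability of `G0sq`. [folklore] -/
instance (m b : ℕ) (v w : Vtx n) : Decidable (G0sq m b v w) := by unfold G0sq; infer_instance

/-- The INDICATOR WEIGHT of an edge predicate on the doubled variables. [folklore] -/
def wInd (E₀ : Vtx n → Vtx n → Prop) [DecidableRel E₀] (e : Var n) : ℕ := if E₀ e.1 e.2 then 1 else 0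

/-! ### Sanity lemmas (definitional unfoldings used by every Part-E file) -/

/-- Membership in the restricted cover set. [folklore] -/
theorem mem_filter_dimers_iff (E₀ : Vtx n → Vtx n → Prop) [DecidableRel E₀] (f : Vtx n → Vtx n) :
    f ∈ (dimers n).filter (fun f => ∀ v, E₀ v (f v)) ↔ IsDimer f ∧ ∀ v, E₀ v (f v) := by
  simp [dimers]

/-- Membership in `sqDimers`. [folklore] -/
theorem mem_sqDimers_iff (f : Vtx n → Vtx n) : f ∈ sqDimers n ↔ IsSqDimer f := by
  simp [sqDimers]

/-- A square edge is a triangular edge. [folklore] -/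
theorem adj_of_sqAdj {v w : Vtx n} (h : SqAdj v w) : Adj v w := by
  unfold SqAdj at h; unfold Adj; tauto

/-- A domino tiling is a dimer cover of the rhombus. [folklore] -/
theorem isDimer_of_isSqDimer {f : Vtx n → Vtx n} (h : IsSqDimer f) : IsDimer f :=
  fun v => ⟨(h v).1, (h v).2.1, adj_of_sqAdj (h v).2.2⟩

/-- `sqDimers n ⊆ dimers n`. [folklore] -/
theorem sqDimers_subset_dimers : sqDimers n ⊆ dimers n := by
  intro f hf
  rw [mem_sqDimers_iff] at hf
  simpa [dimers] using isDimer_of_isSqDimer hf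

/-- `Sq_n` is the inline polynomial of item 5072 (`SquareGridDimersDivisionEasy`). [folklore] -/
theorem sqPM_eq_inline (n : ℕ) : sqPM n =
    ∑ f ∈ (Finset.univ : Finset (Fin n × Fin n → Fin n × Fin n)).filter (fun f => ∀ v, f (f v) = v ∧
      f v ≠ v ∧ (((v.1 : ℕ) + 1 = (f v).1 ∧ (v.2 : ℕ) = (f v).2) ∨ (((f v).1 : ℕ) + 1 = v.1 ∧
      (v.2 : ℕ) = (f v).2) ∨ ((v.1 : ℕ) = (f v).1 ∧ (v.2 : ℕ) + 1 = (f v).2) ∨ ((v.1 : ℕ) = (f v).1 ∧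
      ((f v).2 : ℕ) + 1 = v.2))), ∏ v : Fin n × Fin n, (X (v, f v) : MvPolynomial (Var n) ℝ≥0) := rfl

/-- `triPMIn` of the trivial predicate is `D_n`. [folklore] -/
theorem triPMIn_true : triPMIn (n := n) (fun _ _ => True) = triPM n := by
  unfold triPMIn triPM
  congr 1
  ext f
  simp

/-- ANCHOR of the Part-E vocabulary (registered sub-goal `faceIsolation_sqDimers_subset_dimers`): every
domino tiling of the square is a dimer cover of the rhombus, so `Sq_n`'s covers are among `D_n`'s.
[folklore] -/
theorem faceIsolation_sqDimers_subset_dimers : ∀ (n : ℕ), Summit.ValiantsHypothesis.ValiantsHypothesis.Theorems.DivisionGapZeroOneTransfer.FaceIsolation.sqDimers n ⊆ Summit.ValiantsHypothesis.ValiantsHypothesis.Theorems.TriangularDimersDivisionEasy.Negative.dimers n :=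
  fun _ => sqDimers_subset_dimers

end FaceIsolation

end

end Summit.ValiantsHypothesis.ValiantsHypothesis.Theorems.DivisionGapZeroOneTransfer
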